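import Summits.HodgeConjecture.CorCM.Census.CentralSquaresTieDichotomy

/-!
# The square-central class, XVII: the PAIR CORNER DICHOTOMY at `m = 2` — the level-2 corner `⟨q, q'⟩` of the designated face

COR-CM (cell `pub-hodgecm2`), count-neutral kernel combinatorics by the binder seat b09 (gen 45; lane SQUARE-CENTRAL CLASS, part XVII), on parts III, V–VII, XVI
(`bpot_eq_card_dev_of_le`, `ddist_*`, `cover_frame`, `base_cases_exchange`, `companion_*`, `dev_compl_shapeA`, `dev_frame_shapeB`) and gen 32ʼs
`single_sub_thetaG_mem_of`, BY NAME.  Theorems only; no `decide`, no certificate, no named fact, no `sorry`.  HONEST FRAMING: `HC_CM` is NOT proved, here or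
anywhere in the tree; nothing here is a period or a headline.

The third corner of the designated pair face `{T | a, σa}^(T)` is the level-2 type `⟨a, σa⟩` (deviation set a same-side pair): a tie between `T₀` and `T̄₁`
(shape A₀: pair outside `𝓗`) resp. `T₀` and `T₁` (shape B₀: pair inside `𝓗`) at `m = 2`.  Its cover face is lowering toward one of the two, and the star normal
form toward that base type follows with no strictness needed (`pair_corner_dichotomy_shapeA/B`).  By the design note (`CENTRAL-SQUARES.md` §4) the two normal
forms differ by the `Rᶜ`-relation of the `σζ`-transversal `{a, σa}`, so this ambiguity is absorbed by the two-swap relations.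

## References
* [Pohlmann1968] H. Pohlmann, Algebraic cycles on abelian varieties of complex multiplication type, Ann. of Math. 88 (1968), Thm 1.
* [Milne1999] J. S. Milne, Lefschetz motives and the Tate conjecture, Compositio Math. 117 (1999), Prop. 2.1, p. 54.
-/

namespace Summit.HodgeConjecture.CorCM.Census.CentralSquares

open Finset
open scoped symmDiff
open Summit.HodgeConjecture.CorCM.Prior.AllgGroup.RfwfAllgGroup
open Summit.HodgeConjecture.CorCM.Census.BlockParity
open Summit.HodgeConjecture.CorCM.Census.Coinvariant
open Summit.HodgeConjecture.CorCM.Census.TwistGeneration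
open Summit.HodgeConjecture.CorCM.Census.BaseBlock
open Summit.HodgeConjecture.CorCM.Census.CoverClosure

noncomputable section

variable {G : Type*} [Group G] [Fintype G] [DecidableEq G] (c : G)

/-! ## §1 A face with both deviation places gives the star normal form -/

/-- **Star normal form from the full face.**  If `D_T(Y) = {u, v}` (`u ≠ v`) and the face of `Y` with places `u, v` lies in `L`, then
`[Y] − θ_T(typeSum [Y]) ∈ L` (any base type `T`; the corners are near). [folklore] -/
theorem single_sub_thetaG_mem_of_pair_face (hc2 : c * c = 1) (T : CMF G c) (L : Submodule ℤ (CMF G c →₀ ℤ)) (Y : CMF G c) {u v : G}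
    (huv : u ≠ v) (hY : T.1 \ Y.1 = {u, v}) (hface : gface c hc2 Y u v ∈ L) :
    Finsupp.single Y 1 - thetaG c hc2 T (typeSum G c (Finsupp.single Y 1)) ∈ L := by
  refine single_sub_thetaG_mem_of c T (fun Z => T.1 \ Z.1 ⊆ {u, v}) hc2 L (fun Z hZ h2 => ?_) Y (by rw [hY])
  have hdev : T.1 \ Z.1 = {u, v} := eq_of_subset_of_card_le hZ (by rw [card_pair huv]; exact h2)
  have hZY : Z = Y := eq_of_dev_eq c T (by rw [hdev, hY])
  subst hZY
  have hu : u ∈ T.1 \ Z.1 := by rw [hdev]; simp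
  have hv : v ∈ T.1 \ Z.1 := by rw [hdev]; simp
  have hcorner : ∀ s ∈ T.1 \ Z.1, T.1 \ (oflipCM c hc2 s Z).1 ⊆ {u, v} := fun s hs =>
    (dev_oflip c hc2 (mem_sdiff.mp hs).1 (mem_sdiff.mp hs).2).symm ▸ (erase_subset _ _).trans hZ
  have hu' : u ∈ T.1 \ (oflipCM c hc2 v Z).1 := by
    rw [dev_oflip c hc2 (mem_sdiff.mp hv).1 (mem_sdiff.mp hv).2]; exact mem_erase.mpr ⟨huv, hu⟩
  exact ⟨u, v, hu, hv, huv, hface, hcorner u hu, hcorner v hv,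
    (dev_oflip c hc2 (mem_sdiff.mp hu').1 (mem_sdiff.mp hu').2).symm ▸ (erase_subset _ _).trans (hcorner v hv)⟩

/-! ## §2 Deviation sets of the pair corner in the other frames -/

/-- Shape A₀ seen from `T̄₁`: `D(Y) = {q, q'} ⊆ T₀ ∩ T₁`, `{b, b'} = (T₀ ∩ T₁) ∖ {q, q'}` ⟹ `D_{T̄₁}(Y) = {c·b, c·b'}`. [folklore] -/
theorem dev_compl_pairA (hc2 : c * c = 1) (hcen : ∀ x : G, x * c = c * x) (T₀ T₁ : CMF G c) {q q' : G}
    (hq : q ∈ T₀.1 ∩ T₁.1) (hq' : q' ∈ T₀.1 ∩ T₁.1) (Y : CMF G c) (hY : T₀.1 \ Y.1 = {q, q'})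
    {b b' : G} (hbb : (T₀.1 ∩ T₁.1) \ {q, q'} = {b, b'}) :
    (rt c c T₁).1 \ Y.1 = {c * b, c * b'} := by
  have hHc : T₀.1 \ (rt c c T₁).1 = T₀.1 ∩ T₁.1 := by
    rw [dev_compl c hcen T₀ T₁]; ext x; simp only [mem_sdiff, mem_inter, not_and, not_not]; tauto
  rw [sdiff_eq_of_dev c hc2 T₀ (rt c c T₁) Y, hHc, hY]
  have h1 : ({q, q'} : Finset G) \ (T₀.1 ∩ T₁.1) = ∅ := by
    apply sdiff_eq_empty_iff_subset.mpr
    intro x hx; rw [mem_insert, mem_singleton] at hx; rcases hx with rfl | rfl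
    · exact hq
    · exact hq'
  rw [h1, hbb, image_insert, image_singleton, empty_union]

/-- Shape B₀ seen from `T₁`: `D(Y) = {q, q'} ⊆ 𝓗`, `{h, h'} = 𝓗 ∖ {q, q'}` ⟹ `D_{T₁}(Y) = {c·h, c·h'}`. [folklore] -/
theorem dev_frame_pairB (hc2 : c * c = 1) (T₀ T₁ : CMF G c) {q q' : G}
    (hq : q ∈ T₀.1 \ T₁.1) (hq' : q' ∈ T₀.1 \ T₁.1) (Y : CMF G c) (hY : T₀.1 \ Y.1 = {q, q'})
    {h h' : G} (hhh : (T₀.1 \ T₁.1) \ {q, q'} = {h, h'}) :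
    T₁.1 \ Y.1 = {c * h, c * h'} := by
  rw [sdiff_eq_of_dev c hc2 T₀ T₁ Y, hY]
  have h1 : ({q, q'} : Finset G) \ (T₀.1 \ T₁.1) = ∅ := by
    apply sdiff_eq_empty_iff_subset.mpr
    intro x hx; rw [mem_insert, mem_singleton] at hx; rcases hx with rfl | rfl
    · exact hq
    · exact hq'
  rw [h1, hhh, image_insert, image_singleton, empty_union]

section Frame

variable (hc2 : c * c = 1) (hcen : ∀ x : G, x * c = c * x) (T₀ T₁ : CMF G c)
variable (hbase : ∀ Q : G, rt c Q T₀ = T₀ ∨ rt c Q T₀ = rt c c T₀ ∨ rt c Q T₀ = T₁ ∨ rt c Q T₀ = rt c c T₁)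
variable (m : ℕ) (hn : T₀.1.card = 4 * m) (hH : (T₀.1 \ T₁.1).card = 2 * m)
variable (L : Submodule ℤ (CMF G c →₀ ℤ))
variable (hcover : ∀ Ψ : CMF G c, 2 ≤ bpot c T₀ Ψ → ∃ Q₂ s s' : G, bpot c T₀ Ψ = ddist (rt c Q₂ T₀) Ψ ∧
    s ∈ (rt c Q₂ T₀).1 \ Ψ.1 ∧ s' ∈ (rt c Q₂ T₀).1 \ Ψ.1 ∧ s ≠ s' ∧
    gface c hc2 Ψ s s' ∈ L ∧
    ((∃ Q₁ t t' : G, bpot c T₀ Ψ = ddist (rt c Q₁ T₀) Ψ ∧ t ∈ (rt c Q₁ T₀).1 \ Ψ.1 ∧ t' ∈ (rt c Q₁ T₀).1 \ Ψ.1 ∧ t ≠ t' ∧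
        (∀ Q' : G, ddist (rt c Q' T₀) (oflipCM c hc2 t Ψ) = bpot c T₀ (oflipCM c hc2 t Ψ) → rt c Q' T₀ = rt c Q₁ T₀) ∧
        (∀ Q' : G, ddist (rt c Q' T₀) (oflipCM c hc2 t' Ψ) = bpot c T₀ (oflipCM c hc2 t' Ψ) → rt c Q' T₀ = rt c Q₁ T₀) ∧
        (∀ Q' : G, ddist (rt c Q' T₀) (oflipCM c hc2 t (oflipCM c hc2 t' Ψ)) = bpot c T₀ (oflipCM c hc2 t (oflipCM c hc2 t' Ψ)) →
          rt c Q' T₀ = rt c Q₁ T₀)) →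
      (∀ Q' : G, ddist (rt c Q' T₀) (oflipCM c hc2 s Ψ) = bpot c T₀ (oflipCM c hc2 s Ψ) → rt c Q' T₀ = rt c Q₂ T₀) ∧
      (∀ Q' : G, ddist (rt c Q' T₀) (oflipCM c hc2 s' Ψ) = bpot c T₀ (oflipCM c hc2 s' Ψ) → rt c Q' T₀ = rt c Q₂ T₀) ∧
      (∀ Q' : G, ddist (rt c Q' T₀) (oflipCM c hc2 s (oflipCM c hc2 s' Ψ)) = bpot c T₀ (oflipCM c hc2 s (oflipCM c hc2 s' Ψ)) →
        rt c Q' T₀ = rt c Q₂ T₀)))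

/-! ## §3 Potentials and nearest base changes of the pair corners -/

include hc2 hcen hbase hn hH in
/-- **Shape A₀**: `D(Y) = {q, q'} ⊆ T₀ ∩ T₁` ⟹ `bpot Y = 2`, nearest base changes among `T₀`, `T̄₁` (`m ≥ 2`). [folklore] -/
theorem nearest_pairA (hm : 2 ≤ m) {q q' : G} (hq : q ∈ T₀.1 ∩ T₁.1) (hq' : q' ∈ T₀.1 ∩ T₁.1) (hqq' : q ≠ q')
    (Y : CMF G c) (hY : T₀.1 \ Y.1 = {q, q'}) :
    bpot c T₀ Y = 2 ∧ ∀ Q' : G, ddist (rt c Q' T₀) Y = bpot c T₀ Y → rt c Q' T₀ = T₀ ∨ rt c Q' T₀ = rt c c T₁ := by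
  have hcard : (T₀.1 \ Y.1).card = 2 := by rw [hY, card_pair hqq']
  have hsd : ((T₀.1 \ T₁.1) ∆ (T₀.1 \ Y.1)).card = 2 * m + 2 := by
    rw [hY]
    have e : ({q, q'} : Finset G) = ∅ ∪ {q, q'} := by rw [empty_union]
    rw [e, card_symmDiff_union _ ∅ {q, q'} (empty_subset _) ?_, hH, card_empty, card_pair hqq']
    · omega
    · rw [disjoint_iff_ne]
      rintro x hx y hy rfl
      rw [mem_insert, mem_singleton] at hx
      rcases hx with rfl | rfl
      · exact (mem_sdiff.mp hy).2 (mem_inter.mp hq).2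
      · exact (mem_sdiff.mp hy).2 (mem_inter.mp hq').2
  have hbp : bpot c T₀ Y = 2 := by
    rw [← hcard]
    refine bpot_eq_card_dev_of_le c T₀ T₁ hbase hc2 hcen Y ?_ ?_ ?_
    · rw [hcard, hn]; omega
    · rw [hcard, hsd]; omega
    · rw [hcard, hsd, hn]; omega
  refine ⟨hbp, fun Q' hQ' => ?_⟩
  rcases hbase Q' with h | h | h | h
  · exact Or.inl h
  · exfalso; rw [h, ddist_compl_base_eq c T₀ hc2 hcen, hbp, hn, hcard] at hQ'; omega
  · exfalso; rw [h, ddist_eq_card_symmDiff c T₀ hc2, hbp, hsd] at hQ'; omega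
  · exact Or.inr h

include hc2 hcen hbase hn hH in
/-- **Shape B₀**: `D(Y) = {q, q'} ⊆ 𝓗` ⟹ `bpot Y = 2`, nearest base changes among `T₀`, `T₁` (`m ≥ 2`). [folklore] -/
theorem nearest_pairB (hm : 2 ≤ m) {q q' : G} (hq : q ∈ T₀.1 \ T₁.1) (hq' : q' ∈ T₀.1 \ T₁.1) (hqq' : q ≠ q')
    (Y : CMF G c) (hY : T₀.1 \ Y.1 = {q, q'}) :
    bpot c T₀ Y = 2 ∧ ∀ Q' : G, ddist (rt c Q' T₀) Y = bpot c T₀ Y → rt c Q' T₀ = T₀ ∨ rt c Q' T₀ = T₁ := by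
  have hcard : (T₀.1 \ Y.1).card = 2 := by rw [hY, card_pair hqq']
  have hsub : ({q, q'} : Finset G) ⊆ T₀.1 \ T₁.1 := by
    intro x hx; rw [mem_insert, mem_singleton] at hx; rcases hx with rfl | rfl
    · exact hq
    · exact hq'
  have hsd : ((T₀.1 \ T₁.1) ∆ (T₀.1 \ Y.1)).card = 2 * m - 2 := by
    rw [hY, symmDiff_of_ge hsub, card_sdiff_of_subset hsub, hH, card_pair hqq']
  have hbp : bpot c T₀ Y = 2 := by
    rw [← hcard]
    refine bpot_eq_card_dev_of_le c T₀ T₁ hbase hc2 hcen Y ?_ ?_ ?_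
    · rw [hcard, hn]; omega
    · rw [hcard, hsd]; omega
    · rw [hcard, hsd, hn]; omega
  refine ⟨hbp, fun Q' hQ' => ?_⟩
  rcases hbase Q' with h | h | h | h
  · exact Or.inl h
  · exfalso; rw [h, ddist_compl_base_eq c T₀ hc2 hcen, hbp, hn, hcard] at hQ'; omega
  · exact Or.inr h
  · exfalso; rw [h, ddist_compl_eq c T₀ hc2 hcen, hbp, hsd, hn] at hQ'; omega

/-! ## §4 The dichotomies -/

include hcen hbase hn hH hcover in
/-- **PAIR CORNER DICHOTOMY, shape A₀** (`m ≥ 2`; a genuine dichotomy only at `m = 2`): for `D(Y) = {q, q'} ⊆ T₀ ∩ T₁`,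
`[Y] − θ_{T₀}(typeSum [Y]) ∈ L` or `[Y] − θ_{T̄₁}(typeSum [Y]) ∈ L`. [folklore] -/
theorem pair_corner_dichotomy_shapeA (hm : 2 ≤ m) {q q' : G} (hq : q ∈ T₀.1 ∩ T₁.1) (hq' : q' ∈ T₀.1 ∩ T₁.1) (hqq' : q ≠ q')
    (Y : CMF G c) (hY : T₀.1 \ Y.1 = {q, q'}) :
    Finsupp.single Y 1 - thetaG c hc2 T₀ (typeSum G c (Finsupp.single Y 1)) ∈ L ∨
      Finsupp.single Y 1 - thetaG c hc2 (rt c c T₁) (typeSum G c (Finsupp.single Y 1)) ∈ L := by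
  obtain ⟨hbp, hnear⟩ := nearest_pairA c hc2 hcen T₀ T₁ hbase m hn hH hm hq hq' hqq' Y hY
  obtain ⟨Q₂, s, s', hQ₂, hs, hs', hss', hmem, -⟩ := hcover Y (by rw [hbp])
  rcases hnear Q₂ hQ₂.symm with h0 | h1
  · left
    rw [h0] at hs hs'
    have hpair : ({s, s'} : Finset G) = {q, q'} := by
      apply eq_of_subset_of_card_le
      · intro x hx; rw [← hY]; rw [mem_insert, mem_singleton] at hx; rcases hx with rfl | rfl
        · exact hs
        · exact hs'
      · rw [card_pair hqq', card_pair hss']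
    exact single_sub_thetaG_mem_of_pair_face c hc2 T₀ L Y hss' (by rw [hY, hpair]) hmem
  · right
    rw [h1] at hs hs'
    have hpair : (rt c c T₁).1 \ Y.1 = {s, s'} := by
      apply (eq_of_subset_of_card_le ?_ ?_).symm
      · intro x hx; rw [mem_insert, mem_singleton] at hx; rcases hx with rfl | rfl
        · exact hs
        · exact hs'
      · -- `|D_{T̄₁}(Y)| = ddist T̄₁ Y = 2`
        have hd : ((rt c c T₁).1 \ Y.1).card = 2 := by rw [← ddist_base_eq c (rt c c T₁) Y, ← h1, ← hQ₂, hbp]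
        rw [hd, card_pair hss']
    exact single_sub_thetaG_mem_of_pair_face c hc2 (rt c c T₁) L Y hss' hpair hmem

include hcen hbase hn hH hcover in
/-- **PAIR CORNER DICHOTOMY, shape B₀** (`m ≥ 2`; a genuine dichotomy only at `m = 2`): for `D(Y) = {q, q'} ⊆ 𝓗`,
`[Y] − θ_{T₀}(typeSum [Y]) ∈ L` or `[Y] − θ_{T₁}(typeSum [Y]) ∈ L`. [folklore] -/
theorem pair_corner_dichotomy_shapeB (hm : 2 ≤ m) {q q' : G} (hq : q ∈ T₀.1 \ T₁.1) (hq' : q' ∈ T₀.1 \ T₁.1) (hqq' : q ≠ q')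
    (Y : CMF G c) (hY : T₀.1 \ Y.1 = {q, q'}) :
    Finsupp.single Y 1 - thetaG c hc2 T₀ (typeSum G c (Finsupp.single Y 1)) ∈ L ∨
      Finsupp.single Y 1 - thetaG c hc2 T₁ (typeSum G c (Finsupp.single Y 1)) ∈ L := by
  obtain ⟨hbp, hnear⟩ := nearest_pairB c hc2 hcen T₀ T₁ hbase m hn hH hm hq hq' hqq' Y hY
  obtain ⟨Q₂, s, s', hQ₂, hs, hs', hss', hmem, -⟩ := hcover Y (by rw [hbp])
  rcases hnear Q₂ hQ₂.symm with h0 | h1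
  · left
    rw [h0] at hs hs'
    have hpair : ({s, s'} : Finset G) = {q, q'} := by
      apply eq_of_subset_of_card_le
      · intro x hx; rw [← hY]; rw [mem_insert, mem_singleton] at hx; rcases hx with rfl | rfl
        · exact hs
        · exact hs'
      · rw [card_pair hqq', card_pair hss']
    exact single_sub_thetaG_mem_of_pair_face c hc2 T₀ L Y hss' (by rw [hY, hpair]) hmem
  · right
    rw [h1] at hs hs'
    have hpair : T₁.1 \ Y.1 = {s, s'} := by
      apply (eq_of_subset_of_card_le ?_ ?_).symm
      · intro x hx; rw [mem_insert, mem_singleton] at hx; rcases hx with rfl | rfl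
        · exact hs
        · exact hs'
      · have hd : (T₁.1 \ Y.1).card = 2 := by rw [← ddist_base_eq c T₁ Y, ← h1, ← hQ₂, hbp]
        rw [hd, card_pair hss']
    exact single_sub_thetaG_mem_of_pair_face c hc2 T₁ L Y hss' hpair hmem

end Frame

end

end Summit.HodgeConjecture.CorCM.Census.CentralSquares
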